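import Literature.AlgebraicGeometry.Resolution.BirationalStalkStructureMap
import Literature.AlgebraicGeometry.Resolution.ExceptionalFibreConnected
import Literature.AlgebraicGeometry.Resolution.EffectiveCartierStalks
import Literature.AlgebraicGeometry.Resolution.RegularLocalRingsNormal
import HarnessLib

/-!
# The closed point pulls back to an effective Cartier divisor on a resolution with an exceptional
# curve (Zariski's factorisation step, geometric half)

Topic: `Literature/AlgebraicGeometry/Resolution`. Rows F79-F1-ii / F1-iii of the sub-cell «(1.2) 2-reg»
of the D-0154 (2) RES inputs cell (planner skeleton `F79_2reg_BRICKS_SKELETON.lean`, toward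
`stub_factor`). Let `T` be a two-dimensional regular local ring, `π : X → Spec T` a resolution
(`IsResolution`: proper birational, `X` regular) and `I` the ideal sheaf of the closed point
(`I(⊤) = 𝔪_T`); the structure map `T → 𝒪_{X,x}` and its properties are in
`BirationalStalkStructureMap.lean`.

* `IsResolution.closedFibre_subset_singleton_of_isClosed`,
  `IsResolution.exists_mem_excCurvePoints_specializes_of_nonempty` — Zariski's connectedness step:
  if a resolution of ANY two-dimensional Noetherian local normal domain has an exceptional curve,
  every point of the closed fibre lies on one (the tree's
  `IsResolution.exists_mem_excCurvePoints_specializes` assumed `T` singular instead); hence a closed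
  point of the closed fibre has a two-dimensional local ring
  (`IsResolution.ringKrullDim_stalk_eq_two_of_isClosed_of_nonempty`).
* `exists_stalkIdeal_comap_eq_span_singleton` — **F1-ii**: at every point of its support,
  `(I·𝒪_X)_x = 𝔪_T 𝒪_{X,x}` is generated by a non-zero-divisor (height-one fibre points: `𝒪_{X,x}` is
  a discrete valuation ring; closed fibre points: the key lemma of quadratic transforms,
  Huneke–Swanson Thm. 14.5.2, through `exists_map_maximalIdeal_eq_span_singleton_of_not_surjective`
  — an exceptional curve through `x` makes `T → 𝒪_{X,x}` non-surjective).
* `isEffectiveCartier_comap_of_isResolution_of_excCurvePoints_nonempty` — **F1-iii**: `I·𝒪_X` is an effective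
  Cartier divisor (Stacks 01WS via the tree's `isEffectiveCartier_of_forall_mem_nonZeroDivisors`),
  the hypothesis `hcart` of the universal property of the blowing up of the closed point (row F1-iv,
  `exists_factor_through_blowup_closedPoint_of_isEffectiveCartier`), so that the skeleton's
  `stub_factor` is the composite of the two.

Everything is proved; no definitions, no named facts. Lipman's (1.2) itself is NOT proved here.

## References

* C. Huneke, I. Swanson, *Integral Closure of Ideals, Rings, and Modules*, CUP 2006, Thm. 14.5.2
  and its proof (pp. 276–277). [HunekeSwanson2006]
* J. Lipman, Publ. Math. IHÉS 36 (1969), §10 (p. 212), proof of Prop. (1.2) B) (p. 200). [Lipman1969]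
* The Stacks Project, Tags 01WS (effective Cartier divisors), 03H0 (Zariski connectedness).
  [StacksProject]
-/

noncomputable section

open CategoryTheory CategoryTheory.Limits AlgebraicGeometry TopologicalSpace Topology IsLocalRing
open Literature.AlgebraicGeometry.Morphisms

namespace Literature.AlgebraicGeometry.Resolution

universe u

/-! ## Zariski's connectedness step: every closed-fibre point lies on an exceptional curve -/

section Normal

variable {T : Type u} [CommRing T] [IsDomain T] [IsNoetherianRing T] [IsLocalRing T]
  {X : Scheme.{u}} {π : X ⟶ Spec (.of T)}

/-- **A closed maximal point of the closed fibre is the whole fibre** (resolution of a Noetherian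
local normal domain): if a maximal point `η` of the connected (Zariski) closed fibre `E` is a closed
point of `X`, then `E = {η}` — `{η}` and the union of the closures of the finitely many other maximal
points are disjoint closed sets covering `E`. (The common core of
`IsResolution.exists_mem_excCurvePoints_specializes` and
`IsResolution.closedFibre_subsingleton_of_excCurvePoints_eq_empty`.) [cite: StacksProject, Tag 03H0] -/
theorem IsResolution.closedFibre_subset_singleton_of_isClosed [IsIntegrallyClosed T]
    (hπ : IsResolution π) {η : X} (hη : η ∈ excPoints π) (hcl : IsClosed ({η} : Set X)) :
    π.base ⁻¹' {closedPoint T} ⊆ {η} := by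
  haveI : IsProper π := hπ.isProper
  set E : Set X := π.base ⁻¹' {closedPoint T} with hEdef
  have hE : IsClosed E := (isClosed_singleton_closedPoint T).preimage π.continuous
  have hηmax : η ∈ maxPoints E := hη
  -- the other components of the closed fibre
  set F : Set X := ⋃ η' ∈ excPoints π \ {η}, closure {η'} with hFdef
  have hF : IsClosed F :=
    ((excPoints_finite π).subset fun _ h => h.1).isClosed_biUnion fun _ _ => isClosed_closure
  have hEsub : E ⊆ {η} ∪ F := fun w hw => by
    obtain ⟨η', hη'max, hη'w⟩ := exists_mem_maxPoints_specializes hE hw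
    by_cases hη'η : η' = η
    · subst hη'η
      left
      exact hcl.closure_subset (specializes_iff_mem_closure.mp hη'w)
    · right
      exact Set.mem_biUnion (show η' ∈ excPoints π \ {η} from ⟨hη'max, hη'η⟩)
        (specializes_iff_mem_closure.mp hη'w)
  have hdisj : ∀ w ∈ E, w ∈ ({η} : Set X) → w ∈ F → False := by
    rintro w - rfl hwF
    obtain ⟨η', hη', hwη'⟩ := Set.mem_iUnion₂.mp hwF
    have hsp : η' ⤳ w := specializes_iff_mem_closure.mpr hwη'
    exact hη'.2 (hηmax.2 η' hη'.1.1 hsp)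
  intro w hw
  rcases hEsub hw with h | h
  · exact h
  · exfalso
    have hne : (E ∩ {η}).Nonempty := ⟨η, hη.1, rfl⟩
    obtain ⟨w', hw'E, hw'η, hw'F⟩ := (isPreconnected_closed_iff.mp hπ.isPreconnected_closedFibre)
      {η} F hcl hF hEsub hne ⟨w, hw, h⟩
    exact hdisj w' hw'E hw'η hw'F

/-- **Every point of the closed fibre lies on an exceptional curve, as soon as there is one**
(resolution `π : X → Spec T` of a two-dimensional Noetherian local normal domain, regular or not):
if `excCurvePoints π` is non-empty then every `x` with `π x = 𝔪` has a generisation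
`η ∈ excCurvePoints π`. (A maximal point `η` of the closed fibre above `x` is not closed — otherwise
the fibre would be `{η}` by `IsResolution.closedFibre_subset_singleton_of_isClosed`, and it contains
a non-closed exceptional curve point — hence `η ∈ excCurvePoints π`.) The tree's
`IsResolution.exists_mem_excCurvePoints_specializes` is the case "`T` not regular".
[cite: Lipman1969, Section 10 (p. 212)] -/
theorem IsResolution.exists_mem_excCurvePoints_specializes_of_nonempty [IsIntegrallyClosed T]
    (h2 : ringKrullDim T = 2) (hπ : IsResolution π) (hne : (excCurvePoints π).Nonempty)
    {x : X} (hx : π.base x = closedPoint T) :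
    ∃ η ∈ excCurvePoints π, η ⤳ x := by
  haveI : IsProper π := hπ.isProper
  have hE : IsClosed (π.base ⁻¹' {closedPoint T}) :=
    (isClosed_singleton_closedPoint T).preimage π.continuous
  obtain ⟨η, hηmax, hηx⟩ := exists_mem_maxPoints_specializes hE (show x ∈ _ from hx)
  have hηexc : η ∈ excPoints π := hηmax
  by_cases hcl : IsClosed ({η} : Set X)
  · exfalso
    obtain ⟨η₀, hη₀⟩ := hne
    have hη₀η : η₀ = η := hπ.closedFibre_subset_singleton_of_isClosed hηexc hcl hη₀.1
    exact ((hπ.mem_excCurvePoints_iff h2).1 hη₀).2 (hη₀η ▸ hcl)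
  · exact ⟨η, (hπ.mem_excCurvePoints_iff h2).2 ⟨hηexc, hcl⟩, hηx⟩

/-- **A closed point of the closed fibre has a two-dimensional local ring**, as soon as the
resolution has an exceptional curve (`T` a two-dimensional Noetherian local normal domain): `x` lies
under some `η ∈ excCurvePoints π` with `η ≠ x`, so `2 ≤ coheight x ≤ 2`, i.e. `dim 𝒪_{X,x} = 2`.
[cite: Lipman1969, Section 12 (p. 220)] -/
theorem IsResolution.ringKrullDim_stalk_eq_two_of_isClosed_of_nonempty [IsIntegrallyClosed T]
    (h2 : ringKrullDim T = 2) (hπ : IsResolution π) (hne : (excCurvePoints π).Nonempty)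
    {x : X} (hx : π.base x = closedPoint T) (hcl : IsClosed ({x} : Set X)) :
    ringKrullDim (X.presheaf.stalk x) = 2 := by
  obtain ⟨η, hη, hηx⟩ := hπ.exists_mem_excCurvePoints_specializes_of_nonempty h2 hne hx
  have hxη : x ≠ η := by
    rintro rfl
    exact ((hπ.mem_excCurvePoints_iff h2).1 hη).2 hcl
  have hlt : x < η :=
    ⟨Scheme.le_iff_specializes.2 hηx,
      fun h' => hxη ((Scheme.le_iff_specializes.1 h').antisymm hηx).eq⟩
  have hge : (2 : ℕ∞) ≤ Order.coheight x := by
    have h1 := Order.coheight_add_one_le hlt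
    rw [hπ.coheight_eq_one_of_mem_excCurvePoints h2 hη] at h1
    exact h1
  have hle : Order.coheight x ≤ 2 :=
    le_trans (by simp) (hπ.height_add_coheight_le_two h2.le x)
  rw [ringKrullDim_stalk_eq_coheight x, le_antisymm hle hge]
  rfl

end Normal

/-! ## F1-ii / F1-iii: `𝔪_T·𝒪_X` is an effective Cartier divisor -/

/-- **F1-ii — `(𝔪_T·𝒪_X)_x` is principal, generated by a non-zero-divisor, at every point of its
support**, for `π : X → Spec T` a resolution of a two-dimensional regular local ring having an
exceptional curve. At a height-one fibre point `x ∈ excCurvePoints π` the regular local ring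
`𝒪_{X,x}` has dimension one, so is a discrete valuation ring, and `𝔪_T 𝒪_{X,x} ≠ 0`; at a closed
point `x` of the closed fibre, `dim 𝒪_{X,x} = 2` (`IsResolution.ringKrullDim_stalk_eq_two_of_isClosed_of_nonempty`)
and `T → 𝒪_{X,x}` is an injective, local, birational, non-surjective homomorphism of two-dimensional
regular local rings (`germ_algebraMapΓ_not_surjective`: an exceptional curve passes through `x`), so
the key lemma of quadratic transforms applies (`exists_map_maximalIdeal_eq_span_singleton_of_not_surjective`).
[cite: HunekeSwanson2006, Thm. 14.5.2 (proof, "the crucial point")] -/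
theorem exists_stalkIdeal_comap_eq_span_singleton {T : Type u} [CommRing T] [IsRegularLocalRing T]
    (hT : ringKrullDim T = 2)
    {X : Scheme.{u}} (π : X ⟶ Spec (.of T)) (hπ : IsResolution π)
    (I : (Spec (.of T)).IdealSheafData)
    (hI : I.ideal ⟨⊤, isAffineOpen_top _⟩ =
      Ideal.map (Scheme.ΓSpecIso (.of T)).inv.hom (maximalIdeal T))
    (hne : (excCurvePoints π).Nonempty) {x : X} (hx : x ∈ (I.comap π).support) :
    ∃ g ∈ nonZeroDivisors (X.presheaf.stalk x), stalkIdeal (I.comap π) x = Ideal.span {g} := by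
  haveI := isDomain_of_isRegularLocalRing T
  haveI : IsIntegrallyClosed T := isIntegrallyClosed_of_isRegularLocalRing T
  haveI : IsIntegral X := hπ.isIntegral_source
  haveI : IsRegularLocalRing (X.presheaf.stalk x) := hπ.isRegular x
  have hxc : π.base x = closedPoint T := base_eq_closedPoint_of_mem_support_comap π I hI hx
  set ψ := (X.presheaf.germ ⊤ x trivial).hom.comp (algebraMapΓ π) with hψ
  have hinj : Function.Injective ψ := germ_algebraMapΓ_injective π hπ.isBirational x
  haveI : IsLocalHom ψ := isLocalHom_germ_algebraMapΓ π hxc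
  have h𝔪 : maximalIdeal T ≠ ⊥ := fun h => by
    have h0 := ringKrullDim_eq_zero_of_isField ((IsLocalRing.isField_iff_maximalIdeal_eq).mpr h)
    rw [hT] at h0
    exact absurd h0 (by decide)
  rw [stalkIdeal_comap_eq_map_maximalIdeal π I hI x]
  suffices h : ∃ g : X.presheaf.stalk x, g ≠ 0 ∧ (maximalIdeal T).map ψ = Ideal.span {g} by
    obtain ⟨g, hg0, hg⟩ := h
    exact ⟨g, mem_nonZeroDivisors_of_ne_zero hg0, hg⟩
  rcases hπ.mem_excCurvePoints_or_isClosed hT hxc with hcurve | hclosed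
  · -- `x` on an exceptional curve: `𝒪_{X,x}` is a discrete valuation ring
    have h1 : ringKrullDim (X.presheaf.stalk x) ≤ 1 := by
      rw [ringKrullDim_stalk_eq_coheight x, hπ.coheight_eq_one_of_mem_excCurvePoints hT hcurve]
      rfl
    haveI : IsPrincipalIdealRing (X.presheaf.stalk x) := isPrincipalIdealRing_of_ringKrullDim_le_one h1
    obtain ⟨g, hg⟩ := (IsPrincipalIdealRing.principal ((maximalIdeal T).map ψ)).principal
    refine ⟨g, fun hg0 => h𝔪 ?_, hg⟩
    rw [hg0] at hg
    have : (maximalIdeal T).map ψ = ⊥ := by rw [hg]; simp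
    exact (Ideal.map_eq_bot_iff_of_injective hinj).mp this
  · -- `x` a closed point of the closed fibre: the key lemma
    have h2x : ringKrullDim (X.presheaf.stalk x) = 2 :=
      hπ.ringKrullDim_stalk_eq_two_of_isClosed_of_nonempty hT hne hxc hclosed
    obtain ⟨η, hη, hηx⟩ := hπ.exists_mem_excCurvePoints_specializes_of_nonempty hT hne hxc
    have hηne : η ≠ x := by
      rintro rfl
      exact ((hπ.mem_excCurvePoints_iff hT).1 hη).2 hclosed
    have hns : ¬ Function.Surjective ψ := germ_algebraMapΓ_not_surjective π hηx hηne hη.1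
    exact exists_map_maximalIdeal_eq_span_singleton_of_not_surjective (K := X.functionField) hT h2x ψ
      hinj (exists_eq_div_germ_algebraMapΓ π hπ.isBirational x) hns

/-- **F1-iii — the closed point pulls back to an effective Cartier divisor**: for `T` a
two-dimensional regular local ring, `π : X → Spec T` a resolution having an exceptional curve and `I`
the ideal sheaf of the closed point (`I(⊤) = 𝔪_T`), the pulled-back ideal sheaf `I·𝒪_X = 𝔪_T·𝒪_X` is
an effective Cartier divisor (Stacks 01WS, through `isEffectiveCartier_of_forall_mem_nonZeroDivisors`).
This is the hypothesis `hcart` of the factorisation `π = ρ ≫ bl` through the blowing up of the closed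
point (`exists_factor_through_blowup_closedPoint_of_isEffectiveCartier`).
[cite: HunekeSwanson2006, Thm. 14.5.2] [cite: StacksProject, Tag 01WS] -/
theorem isEffectiveCartier_comap_of_isResolution_of_excCurvePoints_nonempty {T : Type u} [CommRing T]
    [IsRegularLocalRing T] (hT : ringKrullDim T = 2)
    {X : Scheme.{u}} (π : X ⟶ Spec (.of T)) (hπ : IsResolution π)
    (I : (Spec (.of T)).IdealSheafData)
    (hI : I.ideal ⟨⊤, isAffineOpen_top _⟩ =
      Ideal.map (Scheme.ΓSpecIso (.of T)).inv.hom (maximalIdeal T))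
    (hne : (excCurvePoints π).Nonempty) :
    IsEffectiveCartier (I.comap π) := by
  haveI : IsProper π := hπ.isProper
  haveI : IsLocallyNoetherian X := LocallyOfFiniteType.isLocallyNoetherian π
  exact isEffectiveCartier_of_forall_mem_nonZeroDivisors fun x hx =>
    exists_stalkIdeal_comap_eq_span_singleton hT π hπ I hI hne hx

end Literature.AlgebraicGeometry.Resolution

end
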